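import Summits.ResolutionOfSingularities.ResolutionOfSingularities.Theorems.FrobeniusClosingPatchingRelPerfectDepthPhaseCCarrierGameLiftWin
import Summits.ResolutionOfSingularities.ResolutionOfSingularities.Theorems.FrobeniusClosingPatchingRelPerfectMonomialGamePrincipalization
import Summits.ResolutionOfSingularities.ResolutionOfSingularities.Theorems.FrobeniusClosingPatchingRelPerfectDepthMultiHostEnd
import Literature.AlgebraicGeometry.Resolution.BlowupSequences
import HarnessLib

/-!
# Crux `PatchingRelPerfect` (stmt-ResolutionOfSingularities-16161), chain W5.2 — F7(β) (β-AX) X3 C-I finish, CE1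
# `…DepthPhaseCCarrierGameLift`, part 2 (DICTIONARY): a marking-ONE winnable game state RESOLVES the marked ideal `(Σ 𝒦, Es, 1)`
# — the blow-up sequence is admissible and the final controlled transform is the UNIT ideal

[OURS · L1 W5.2 · res-L1-w52-plan-1 NOTE G11-40 (3) / G11-49 (2) → res-D-pv-046 g9; design of record
`D/res-D-pv-046/DepthPhaseCCarrierGameLift.scratch.v2.lean` (P2)] Replaces the role of NO printed item; fact-free; any dimension.

The marking-ONE twin of the tree's weight-0 dictionary `MonomialCleanup.exists_centreSeq_of_winnable` (…MonomialGamePrincipalization):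
induction on `PolyhedraGame.WinnablePos 1` through the invariant `GameInv` (…MonomialGameBridge); per move, the centre is the stratum
`C = ⨆_{k ∈ pos J} Es[k]` of the positions of `J` — regular (`HasSNC.isRegular_subscheme_finsetSup`), snc with the boundary
(`HasSNC.hasSNCWith_finsetSup`), inside the cosupport (`support_centre_subset`) = the marking-one support (`MarkedIdeal.support_of_mult_eq_one`);
the successor datum is the marked move `gameInv_move_of_permissibleM` (…MonomialGameMoveMarked) along `blowup.π C`, and the transformed
marked ideal `(Σ 𝒦, Es, 1).transform` IS the successor datum `(Σ 𝒦', Es', 1)` by the weight-one identity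
`DepthMultiHost.controlledTransform_monomialSum_stratum` (…DepthMultiHostEnd) when the centre is non-empty (then the positions of `J` have
a common point and permissibility gives weight `≥ 1` on `C` for every member, `weightOf_image_nthSheaf_eq_sum`), and by the trivial
identity `πᶜ(I; ⊤, 1) = π^*I` when the centre is EMPTY (`C = ⊤`; both transformed families then differ only in the exponent of the
member `⊤`). END: a marking-one win is the unit ideal (`monomialSum_eq_top_of_wonM_one`, part 1 p556330).

* `monomialSum_map_transformExp_eq_of_sup_eq_top` — the empty-centre bookkeeping.
* **`exists_isAdmissibleFor_of_winnablePos_one`** — `WinnablePos 1 s`, `GameInv s Es 𝒦 lab` ⇒ `∃ t : CentreSeq X`, `t.IsAdmissibleFor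
  ⟨Σ 𝒦, Es, 1⟩ ∧ Scheme.IsRegular t.top ∧ (t.transformMarked ⟨Σ 𝒦, Es, 1⟩).ideal = ⊤`.

## References (for the mathematics; nothing here is a statement of the manuscript under review)
* J. Kollár, *Lectures on Resolution of Singularities* (2007), (3.111) Step 3. [Kollar2007]
* E. Bierstone, D. Grigoriev, P. Milman, J. Włodarczyk, arXiv:1206.3090, Def. 3.1.3. [BierstoneGrigorievMilmanWlodarczyk2011]
-/

-- `Summit.<Summit>.<Sub>.Theorems` with `Sub = Summit` (single-conjunct summit, D-0017)
set_option linter.dupNamespace false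

noncomputable section

open CategoryTheory AlgebraicGeometry TopologicalSpace IsLocalRing
open Literature.AlgebraicGeometry.Resolution

namespace Summit.ResolutionOfSingularities.ResolutionOfSingularities.Theorems

namespace MonomialCleanup

open DepthTargets (monomialSum monomialSum_nil monomialSum_cons)
open PolyhedraGame (State WinnablePos WonM PermissibleM Permissible move weight permissibleM_one_iff)

universe u

variable {X X' : Scheme.{u}}

/-! ## The empty-centre bookkeeping -/

/-- If the centre `⨆ T` is the unit ideal (empty), the two transformed families with bookkeeping weights `m` and `0` generate the
same sum: they differ only in the exponent of the member `(⨆ T)·𝒪 = ⊤`. [folklore] -/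
theorem monomialSum_map_transformExp_eq_of_sup_eq_top {π : X' ⟶ X} {T : Finset X.IdealSheafData} (hT : T.sup id = ⊤)
    (𝒦 : List (List (X.IdealSheafData × ℕ))) (m : ℕ) :
    monomialSum (𝒦.map fun A => transformExp A π T m) = monomialSum (𝒦.map fun A => transformExp A π T 0) := by
  have hmem : ∀ (A : List (X.IdealSheafData × ℕ)) (n : ℕ),
      monomialIdeal (transformExp A π T n) = monomialIdeal (A.map fun p => (strictTransformIdeal π (T.sup id) p.1, p.2)) := by
    intro A n
    rw [transformExp, monomialIdeal_append, monomialIdeal_cons, monomialIdeal_nil, hT, Scheme.IdealSheafData.comap_top]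
    simp only [← Scheme.IdealSheafData.one_eq_top, one_pow, mul_one]
  induction 𝒦 with
  | nil => rfl
  | cons A 𝒦 ih => rw [List.map_cons, List.map_cons, monomialSum_cons, monomialSum_cons, hmem, hmem, ih]

/-! ## The induction on `WinnablePos 1` -/

open Classical in
/-- **A marking-one winnable state resolves `(Σ 𝒦, Es, 1)`.** [cite: Kollar2007, (3.111) Step 3]
[cite: BierstoneGrigorievMilmanWlodarczyk2011, Def. 3.1.3] -/
theorem exists_isAdmissibleFor_of_winnablePos_one {s : State} (hw : WinnablePos 1 s) :
    ∀ (X : Scheme.{u}) [IsLocallyNoetherian X] (Es : List X.IdealSheafData)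
      (𝒦 : List (List (X.IdealSheafData × ℕ))) (lab : ℕ → ℕ), GameInv s Es 𝒦 lab →
      ∃ t : CentreSeq X, t.IsAdmissibleFor ⟨monomialSum 𝒦, Es, 1⟩ ∧ Scheme.IsRegular t.top ∧
        (t.transformMarked ⟨monomialSum 𝒦, Es, 1⟩).ideal = ⊤ := by
  induction hw with
  | done hwon =>
    intro X _ Es 𝒦 lab hinv
    exact ⟨CentreSeq.nil X, trivial, fun x => (hinv.snc x).1, monomialSum_eq_top_of_wonM_one hinv hwon⟩
  | @step s J hJ he _ ih =>
    intro X _ Es 𝒦 lab hinv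
    set P := posOf Es lab J with hPdef
    set T := P.image (nthSheaf Es) with hTdef
    set C : X.IdealSheafData := T.sup id with hC
    have hJ' : Permissible s J := (permissibleM_one_iff s J).mp hJ
    have hJB : J ⊆ s.B := hinv.str_B J hJ.1
    have hPlt : ∀ k ∈ P, k < Es.length := fun k hk => (mem_posOf_iff.mp hk).1
    have hT : ∀ K ∈ T, K ∈ Es := image_nthSheaf_subset hPlt
    have hπ : IsBlowup (blowup.π C) (T.sup id) := blowup.isBlowup C
    haveI : IsLocallyNoetherian (blowup C) := CentreSeq.isLocallyNoetherian_blowup C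
    have hinv' := gameInv_move_of_permissibleM (π := blowup.π C) (e := s.B.card) hinv hJ he hπ
    obtain ⟨t, hadm, htop, hideal⟩ := ih (blowup C) _ _ _ hinv'
    -- the transformed marked ideal is the successor datum
    have hkey : controlledTransform (blowup.π C) (T.sup id) (monomialSum 𝒦) 1 =
        monomialSum (𝒦.map fun A => transformExp A (blowup.π C) T 1) := by
      by_cases hCtop : T.sup id = ⊤
      · -- empty centre: both sides are the total transform
        rw [controlledTransform, hCtop, Scheme.IdealSheafData.comap_top, pow_one, colon_top,
          monomialSum_map_transformExp_eq_of_sup_eq_top hCtop,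
          comap_monomialSum_eq_pow_mul hinv.snc hinv.bd hT hπ (m := 0) (fun A _ => Nat.zero_le _), pow_zero, one_mul]
      · -- non-empty centre: a common point of the positions of `J`, weights `≥ 1`
        have hne : ((T.sup id).support : Set X).Nonempty := by
          by_contra h
          have hbot : (T.sup id).support = ⊥ := le_bot_iff.mp fun x hx => (h ⟨x, hx⟩).elim
          exact hCtop ((Scheme.IdealSheafData.support_eq_bot_iff (I := T.sup id)).mp hbot)
        obtain ⟨x, hx⟩ := hne
        have hPx : ∀ k ∈ P, x ∈ (nthSheaf Es k).support := fun k hk =>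
          (mem_support_finsetSup_iff T _).mp hx _ (Finset.mem_image_of_mem _ hk)
        refine DepthMultiHost.controlledTransform_monomialSum_stratum hinv.snc hinv.bd hT hπ fun A hA => ?_
        obtain ⟨α, hα, hagr⟩ := hinv.fwd A hA
        have hlenA : A.length = Es.length := hinv.length_eq hA
        have hPD : PointedDistinct (boundaryOf A) := (hinv.bd A hA).symm ▸ hinv.pd
        have hPltA : ∀ k ∈ P, k < A.length := fun k hk => hlenA ▸ hPlt k hk
        have hPxA : ∀ k ∈ P, x ∈ (nthSheaf (boundaryOf A) k).support := fun k hk => by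
          rw [hinv.bd A hA]; exact hPx k hk
        have hw := weightOf_image_nthSheaf_eq_sum hPD hPltA hPxA
        rw [hinv.bd A hA] at hw
        rw [hw, show ∑ k ∈ P, nthExp A k = ∑ k ∈ P, α (lab k) from
          Finset.sum_congr rfl fun k hk => (hagr k (hPlt k hk) ⟨x, hPx k hk⟩).symm, ← weight_eq_sum_posOf hinv hJB]
        exact hJ.2.2 α hα
    have htr : (⟨monomialSum 𝒦, Es, 1⟩ : MarkedIdeal X).transform (blowup.π C) C =
        ⟨monomialSum (𝒦.map fun A => transformExp A (blowup.π C) T 1),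
          Es.map (strictTransformIdeal (blowup.π C) (T.sup id)) ++ [(T.sup id).comap (blowup.π C)], 1⟩ := by
      simp only [MarkedIdeal.transform, hC, hkey]
    refine ⟨CentreSeq.cons C t, ?_, htop, ?_⟩
    · refine (CentreSeq.isAdmissibleFor_cons C t _).mpr ⟨?_, hinv.snc.hasSNCWith_finsetSup T hT,
        hinv.snc.isRegular_subscheme_finsetSup T hT, ?_⟩
      · rw [MarkedIdeal.support_of_mult_eq_one _ rfl]
        exact support_centre_subset hinv hJ'
      · rw [htr]; exact hadm
    · rw [CentreSeq.transformMarked_cons, htr]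
      exact hideal

end MonomialCleanup

end Summit.ResolutionOfSingularities.ResolutionOfSingularities.Theorems

end
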